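import Mathlib.Analysis.SpecialFunctions.Pow.Real
import Mathlib.Tactic
import HarnessLib

/-!
# Kerr is Ricci-flat, algebra VI: the contractions `Φ_{kl}`, `k = 2, 3`

Support file for the stub `stub_kerrVacuum` of line `tapered-temporal-collar` (crux
`stmt-FinalStateConjecture-10054`): the Kerr metric `g_{M,a} = η + 2H ℓ ⊗ ℓ` in ingoing
Kerr–Schild Cartesian coordinates is Ricci-flat for all real `M, a, r₀` (`Kerr.isRicciFlat`).
The pure algebra is done over six real variables `(a, M, x₁, x₂, r, c)`: at a point of the chart
with Kerr–Schild radius `r > 0` put `c = z/r` (`= cos θ`), so that the defining quartic of `r`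
reads `x₂² = (r² + a²)(1 − c²) − x₁²`, and `Σ = r² + a²c²`, `H = M r/Σ`,
`ℓ = (1, (r x₁ + a x₂)/(r² + a²), (r x₂ − a x₁)/(r² + a²), c)`.
This part proves the closed forms of `Φ_{kl} = ∑_{iβ} g^{iβ} ∂_i∂_k g_{lβ}` for `k = 2, 3`.
Kerr–Schild 1965, §3.

## References

* R. P. Kerr, *Gravitational field of a spinning mass as an example of algebraically special
  metrics*, Phys. Rev. Lett. 11 (1963) 237–238.
* R. P. Kerr, A. Schild, *A new class of vacuum solutions of the Einstein field equations*
  (1965), §§2–3.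
* M. Visser, *The Kerr spacetime: a brief introduction*, arXiv:0706.0622, (32)–(36).
* B. O'Neill, *The geometry of Kerr black holes* (1995), Ch. 2, Thm. 2.6.1.
-/

set_option linter.dupNamespace false
set_option linter.unusedSimpArgs false
set_option linter.unusedTactic false
set_option linter.unreachableTactic false
set_option linter.unnecessarySeqFocus false

noncomputable section

namespace Summit.FinalStateConjecture.FinalStateConjecture.Theorems.SwallowTheDatum.KerrShieldedSettles

namespace StubKerrVacuum

/-- `x^3` reduced modulo a relation `x² = W`. [folklore] -/
theorem xp3 {x W : ℝ} (h : x^2 = W) : x^3 = x * W := by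
  rw [← h]; ring

/-- `x^4` reduced modulo a relation `x² = W`. [folklore] -/
theorem xp4 {x W : ℝ} (h : x^2 = W) : x^4 = W^2 := by
  rw [← h]; ring

/-- `x^5` reduced modulo a relation `x² = W`. [folklore] -/
theorem xp5 {x W : ℝ} (h : x^2 = W) : x^5 = x * W^2 := by
  rw [← h]; ring

/-- `x^6` reduced modulo a relation `x² = W`. [folklore] -/
theorem xp6 {x W : ℝ} (h : x^2 = W) : x^6 = W^3 := by
  rw [← h]; ring

/-- `x^7` reduced modulo a relation `x² = W`. [folklore] -/
theorem xp7 {x W : ℝ} (h : x^2 = W) : x^7 = x * W^3 := by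
  rw [← h]; ring

/-- `x^8` reduced modulo a relation `x² = W`. [folklore] -/
theorem xp8 {x W : ℝ} (h : x^2 = W) : x^8 = W^4 := by
  rw [← h]; ring

/-- `x^9` reduced modulo a relation `x² = W`. [folklore] -/
theorem xp9 {x W : ℝ} (h : x^2 = W) : x^9 = x * W^4 := by
  rw [← h]; ring

/-- `x^10` reduced modulo a relation `x² = W`. [folklore] -/
theorem xp10 {x W : ℝ} (h : x^2 = W) : x^10 = W^5 := by
  rw [← h]; ring

/-- `x^11` reduced modulo a relation `x² = W`. [folklore] -/
theorem xp11 {x W : ℝ} (h : x^2 = W) : x^11 = x * W^5 := by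
  rw [← h]; ring

/-- `x^12` reduced modulo a relation `x² = W`. [folklore] -/
theorem xp12 {x W : ℝ} (h : x^2 = W) : x^12 = W^6 := by
  rw [← h]; ring

/-- `x^13` reduced modulo a relation `x² = W`. [folklore] -/
theorem xp13 {x W : ℝ} (h : x^2 = W) : x^13 = x * W^6 := by
  rw [← h]; ring

/-- `x^14` reduced modulo a relation `x² = W`. [folklore] -/
theorem xp14 {x W : ℝ} (h : x^2 = W) : x^14 = W^7 := by
  rw [← h]; ring

/-- `x^15` reduced modulo a relation `x² = W`. [folklore] -/
theorem xp15 {x W : ℝ} (h : x^2 = W) : x^15 = x * W^7 := by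
  rw [← h]; ring

/-- `x^16` reduced modulo a relation `x² = W`. [folklore] -/
theorem xp16 {x W : ℝ} (h : x^2 = W) : x^16 = W^8 := by
  rw [← h]; ring

end StubKerrVacuum

/-- **Registered sub-goal `stub_kerrVacuumPowRel`** of stub `stub_kerrVacuum` (line
`tapered-temporal-collar`): powers of `x₂` reduce modulo the quartic relation `x₂² = W` (the
rewrite rules of this file).
[cite: KerrSchild1965, §3] -/
theorem stub_kerrVacuumPowRel : ∀ (x W : ℝ), x ^ 2 = W → x ^ 16 = W ^ 8 :=
  fun _ _ h ↦ StubKerrVacuum.xp16 h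

end Summit.FinalStateConjecture.FinalStateConjecture.Theorems.SwallowTheDatum.KerrShieldedSettles
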